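import Summits.Ventures.CertifiedManyBodySolver.Certificates.HubbardSquare_n7o8_pinning_menuA0_tPrimeBox_pairAmpCeilings_diagHopWindow
import Summits.Ventures.CertifiedManyBodySolver.Certificates.HubbardSquare_n7o8_boxword_cuprate_v3
import HarnessLib
import HarnessLib.Audit

/-!
# Ventures/CertifiedManyBodySolver — Certificates/HubbardSquare_n7o8_pinning_menuA0_tPrimeUBox_pairAmpCeilings.lean

HONEST FRAMING: first certified bounds; not a superconductivity verdict; every number certified or labelled float. A CEILING on a
`d`-wave pair amplitude never speaks to the presence or absence of order; no phase sentence; CANDIDATE until the named nodes are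
referee-replayed. WHAT-THIS-IS-NOT: a floor; a number of record beyond its named premises; the filling stays the POINT `n = 7/8`
(interval-filling menus are not run; `DWaveSourceCapClassTPrimeTransport` §7 is the consumer shape when they are).

THE `(t', U)` FACE of the cuprate box of record `(U, t', n) = (8 ± 1/2, −1/4 ± 1/20, 7/8)` for the ORDER word (hubbard-box-p3 g4; sequel of
`…menus_tPrimeBox_pairAmpCeilings.lean` p486616 and `…_diagHopWindow.lean` p487004, which serve the `t'`-extent at `U = 8`). TARGET CAPS on the
face = box-eng-2's v3 upper face function BY NAME (`boxCuprate_v3_tface_upper_of h445 h257lo h257up hτ3`: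
`e(1,t',U,7/8) ≤ hi₄₄₅ + max((U−8)·D₂₅₇lo, (U−8)·D₂₅₇hi) + max((t'+1/4)·(−0.6023622597), (t'+1/4)·1.0872271385)`); TRANSPORT =
`canonicalMinimiser_le_priced_of_capClass_tPrime_U` (`DWaveSourceCapClassTPrimeTransport.lean` p484647: target state's anchor energy
`≤ R(t',U) + (16/π²)|Δt'| + max(8 − U, 0)·(7/16)` — UPWARD in `U` free, DOWNWARD kinematic `D ≤ n/2`); NODE = pin-1's PRICED A0 L2 `g = 0`
node (h = 0: the ORDER-PARAMETER class; `M̃ = 1.0748043095`, `κ = 20946234030731/2⁴⁴`). RESULT: every translation-invariant density-7/8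
GROUND STATE of the `t–t'` Hubbard model at ANY `(t', U)` of the face has `Re ω(P₀^d) ≤ 0.9137975` on the upper half `U ∈ [8, 17/2]` and
`≤ 1.0581856` on the lower half `U ∈ [15/2, 8]`, hence `≤ 1.0581856` on the whole face (anchor-point value `0.7600015`; `t'`-extent alone
`0.8740155`). Premises BY NAME: priced node (CANDIDATE), #445, #257 docc rows (`cert_r257_lro_…_Dlo/_Dup`), `hτ3` (eng A8m25 `K₂` window, box-eng-2's
hypothesis). §1 generic face lemma; §2 the three instances.

References: T. Koma, H. Tasaki, J. Stat. Phys. 76 (1994) 745 §1; J. Wang et al., Phys. Rev. X 14 (2024) 031006 §III; D. Ruelle, Statistical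
Mechanics (1969) §3.4 (`0 ≤ D ≤ ρ/2`).
-/

noncomputable section

namespace Summit.Ventures.CertifiedManyBodySolver.Certificates

open Literature.MathematicalPhysics.QuantumLattice Literature.MathematicalPhysics.QuantumLattice.ThermodynamicLimit
open Literature.Probability.LatticeModels HubbardWave0 InfVolFermionState
open Summit.Ventures.CertifiedManyBodySolver
open scoped ComplexOrder

/-! ### §1 Generic: priced node at `(t'₀, U₀)` + a uniform TARGET-CAP excess on a `(t', U)` box ⇒ pair-amplitude ceiling on the box -/

/-- **`(t', U)`-BOX PAIR-AMPLITUDE CEILING FROM ONE PRICED MENU NODE**: a priced class sentence at the anchor `(t'₀, U₀, h)`, canonical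
target caps `e(1,t',U;n) ≤ u₀ + c_R` uniformly on the box `[s₁,s₂] × [U₁,U₂]` (`U₁ ≥ 0`), `|t'₀ − t'| ≤ r` on `[s₁,s₂]`, the downward-`U`
kinematic price `max(U₀ − U₁, 0)·(n/2) ≤ c_U`, and the slot inequality `M̃ + κ·(c_R + 1.6212·r + c_U) ≤ M·1.41421356` give
`Re ω(P₀^d) ≤ M` for every density-`n` sourced minimiser at every `(t', U)` of the box. Ceiling only. -/
theorem pairAmp_le_slot_on_tPrimeUBox_of_pricedNode {t'₀ U₀ n h u₀ Mt κ M cR cU r s₁ s₂ U₁ U₂ : ℝ} (hU₁ : 0 ≤ U₁)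
    (hn0 : 0 ≤ n) (hn2 : n < 2) (hκ : 0 ≤ κ) (hM : 0 ≤ M)
    (hP : ∀ σ : InfVolFermionState 2, σ.IsTranslationInvariant → σ.density = n →
      Real.sqrt 2 * (σ.expect (pairRegion (insert 0 unitSteps) 0) (localPairAt (insert 0 unitSteps) dWaveFormFactor 0)).re ≤
        Mt + κ * (σ.meanEnergy (hubbardTTPrimeSourcedInteraction 1 t'₀ U₀ 0 dWaveFormFactor h) 1 - u₀))
    (hR : ∀ t' ∈ Set.Icc s₁ s₂, ∀ U ∈ Set.Icc U₁ U₂, energyDensityTT' 1 t' U n ≤ u₀ + cR)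
    (hr : max (t'₀ - s₁) (s₂ - t'₀) ≤ r) (hcU : max (U₀ - U₁) 0 * (n / 2) ≤ cU)
    (hslot : Mt + κ * (cR + 1.6212 * r + cU) ≤ M * (141421356 / 100000000 : ℝ))
    {t' U : ℝ} (ht : t' ∈ Set.Icc s₁ s₂) (hUm : U ∈ Set.Icc U₁ U₂)
    {ω : InfVolFermionState 2} (hω : ω.IsTranslationInvariant) (hρ : ω.density = n)
    (hmin : ∀ ω' : InfVolFermionState 2, ω'.IsTranslationInvariant → ω'.density = n →
      ω.meanEnergy (hubbardTTPrimeSourcedInteraction 1 t' U 0 dWaveFormFactor h) 1 ≤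
        ω'.meanEnergy (hubbardTTPrimeSourcedInteraction 1 t' U 0 dWaveFormFactor h) 1) :
    (ω.expect (pairRegion (insert 0 unitSteps) 0) (localPairAt (insert 0 unitSteps) dWaveFormFactor 0)).re ≤ M := by
  have hU : 0 ≤ U := hU₁.trans hUm.1
  have key := canonicalMinimiser_le_priced_of_capClass_tPrime_U
    (f := fun σ => Real.sqrt 2 * (σ.expect (pairRegion (insert 0 unitSteps) 0)
      (localPairAt (insert 0 unitSteps) dWaveFormFactor 0)).re) hU hn0 hn2 hκ hP (hR t' ht U hUm) hω hρ hmin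
  have hpi := sixteen_div_pi_sq_lt_decimal
  -- |t'₀ − t'| ≤ r
  have habs : |t'₀ - t'| ≤ r := by
    refine le_trans ?_ hr
    rw [abs_le]; constructor
    · have := le_max_right (t'₀ - s₁) (s₂ - t'₀); linarith [ht.2]
    · have := le_max_left (t'₀ - s₁) (s₂ - t'₀); linarith [ht.1]
  -- max(U₀ − U, 0)·(n/2) ≤ cU
  have hmaxU : max (U₀ - U) 0 ≤ max (U₀ - U₁) 0 :=
    max_le_max (by linarith [hUm.1]) le_rfl
  have hn2' : 0 ≤ n / 2 := by linarith
  have hcU' : max (U₀ - U) 0 * (n / 2) ≤ cU := (mul_le_mul_of_nonneg_right hmaxU hn2').trans hcU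
  have h0 : 0 ≤ |t'₀ - t'| := abs_nonneg _
  have hκ2 : κ * (u₀ + cR + 16 / Real.pi ^ 2 * |t'₀ - t'| + max (U₀ - U) 0 * (n / 2) - u₀) ≤
      κ * (cR + 1.6212 * r + cU) := by
    apply mul_le_mul_of_nonneg_left _ hκ
    nlinarith [mul_le_mul_of_nonneg_left habs (show (0:ℝ) ≤ 1.6212 by norm_num), mul_le_mul_of_nonneg_right hpi.le h0]
  exact le_slot_of_sqrt_two_mul_le (by simpa using key.trans (by linarith)) hM hslot

/-! ### §2 A0 L2 `g = 0` (ORDER-PARAMETER class) on the `(t', U)` face `[−3/10, −1/5] × [15/2, 17/2]` of the cuprate box -/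

section Face

variable (hP : cert_pin2_A0menu_L2_U8_n7o8_tpm1o4_g0_pairAmpMax_priced_j256528) (h445 : cert_dbt329pair_allk)
  (h257lo : cert_r257_lro_M3U8tpm1o4_w2_b4_kry1_kry2c3_hop2_Dlo)
  (h257up : cert_r257_lro_M3U8tpm1o4_w2_b4_kry1_kry2c3_hop2_Dup)
  (hτ3 : ∀ (ω : InfVolFermionState 2) (Ls : ℕ → ℕ) (ψ : ∀ L, Fock (Orb (FermionTorus 2 L))),
    Filter.Tendsto Ls Filter.atTop Filter.atTop →
    (∀ j, IsGroundStateInSector (hubbardTorusTT' (Ls j) 1 (-1/4) 8) (rectN (7/8) (Ls j)) 0 (ψ (Ls j))) →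
    (∀ j, star (ψ (Ls j)) ⬝ᵥ ψ (Ls j) = 1) → ω.IsTorusLimitOf ψ Ls →
    ((-6023622597/10000000000 : ℚ) : ℝ) ≤ ω.meanEnergy (hubbardTTPrimeFermionInteraction 0 1 0) 1 ∧
      ω.meanEnergy (hubbardTTPrimeFermionInteraction 0 1 0) 1 ≤ ((2174454277/2000000000 : ℚ) : ℝ))

include hP h445 h257lo h257up hτ3

omit hP in
/-- The v3 face cap read as a uniform excess on the UPPER-`U` half-face `[−3/10, −1/5] × [8, 17/2]`:
`e(1,t',U,7/8) ≤ hi₄₄₅ + (D₂₅₇hi/2 + 1.0872271385/20)`. -/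
theorem faceCap_excess_upperHalf {t' U : ℝ} (ht : t' ∈ Set.Icc (-3/10 : ℝ) (-1/5)) (hUm : U ∈ Set.Icc (8 : ℝ) (17/2)) :
    energyDensityTT' 1 t' U (7/8) ≤ (((-12079530027017/17592186044416 : ℚ)) : ℝ) +
      ((456988009968292079185545/4835703278458516698824704 : ℝ) / 2 + (2174454277/2000000000 : ℝ) / 20) := by
  have hface := boxCuprate_v3_tface_upper_of h445 h257lo h257up hτ3 t' (U := U) (by linarith [hUm.1])
  have h1 : max ((U - 8) * (38455087907569911627595/4835703278458516698824704 : ℝ))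
      ((U - 8) * (456988009968292079185545/4835703278458516698824704 : ℝ)) ≤
      (456988009968292079185545/4835703278458516698824704 : ℝ) / 2 := by
    refine max_le ?_ ?_ <;> nlinarith [hUm.1, hUm.2]
  have h2 : max ((t' - (-1/4)) * (((-6023622597/10000000000 : ℚ)) : ℝ))
      ((t' - (-1/4)) * (((2174454277/2000000000 : ℚ)) : ℝ)) ≤ (2174454277/2000000000 : ℝ) / 20 := by
    refine max_le ?_ ?_ <;> push_cast <;> nlinarith [ht.1, ht.2]
  linarith

omit hP in
/-- The v3 face cap read as a uniform excess on the LOWER-`U` half-face `[−3/10, −1/5] × [15/2, 8]` (the `U`-term is `≤ 0` there):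
`e(1,t',U,7/8) ≤ hi₄₄₅ + 1.0872271385/20`. -/
theorem faceCap_excess_lowerHalf {t' U : ℝ} (ht : t' ∈ Set.Icc (-3/10 : ℝ) (-1/5)) (hUm : U ∈ Set.Icc (15/2 : ℝ) 8) :
    energyDensityTT' 1 t' U (7/8) ≤ (((-12079530027017/17592186044416 : ℚ)) : ℝ) + (2174454277/2000000000 : ℝ) / 20 := by
  have hface := boxCuprate_v3_tface_upper_of h445 h257lo h257up hτ3 t' (U := U) (by linarith [hUm.1])
  have h1 : max ((U - 8) * (38455087907569911627595/4835703278458516698824704 : ℝ))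
      ((U - 8) * (456988009968292079185545/4835703278458516698824704 : ℝ)) ≤ 0 := by
    refine max_le ?_ ?_ <;> nlinarith [hUm.1, hUm.2]
  have h2 : max ((t' - (-1/4)) * (((-6023622597/10000000000 : ℚ)) : ℝ))
      ((t' - (-1/4)) * (((2174454277/2000000000 : ℚ)) : ℝ)) ≤ (2174454277/2000000000 : ℝ) / 20 := by
    refine max_le ?_ ?_ <;> push_cast <;> nlinarith [ht.1, ht.2]
  linarith

/-- **ORDER-PARAMETER CEILING ON THE UPPER-`U` HALF-FACE**: for every `(t', U) ∈ [−0.30, −0.20] × [8, 8.5]`, every translation-invariant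
density-7/8 GROUND STATE of the `t–t'` Hubbard model has **`Re ω(P₀^d) ≤ 0.9137975`** (slot `365519/400000`; upward in `U` free, excess
`D₂₅₇hi/2 + 1.0872271385/20 + 1.6212/20 = 0.18267…`). Premises BY NAME: priced A0 L2 g=0 node (CANDIDATE), #445, #257 docc rows, `hτ3`.
Ceiling only; no phase sentence. -/
theorem pin2_A0menu_L2_g0_groundState_pairAmp_le_on_tPrimeUFace_upperHalf {t' U : ℝ} (ht : t' ∈ Set.Icc (-3/10 : ℝ) (-1/5))
    (hUm : U ∈ Set.Icc (8 : ℝ) (17/2))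
    {ω : InfVolFermionState 2} (hω : ω.IsTranslationInvariant) (hρ : ω.density = 7 / 8)
    (hmin : ∀ ω' : InfVolFermionState 2, ω'.IsTranslationInvariant → ω'.density = 7 / 8 →
      ω.meanEnergy (hubbardTTPrimeSourcedInteraction 1 t' U 0 dWaveFormFactor 0) 1 ≤
        ω'.meanEnergy (hubbardTTPrimeSourcedInteraction 1 t' U 0 dWaveFormFactor 0) 1) :
    (ω.expect (pairRegion (insert 0 unitSteps) 0) (localPairAt (insert 0 unitSteps) dWaveFormFactor 0)).re ≤
      (((365519/400000 : ℚ)) : ℝ) := by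
  refine pairAmp_le_slot_on_tPrimeUBox_of_pricedNode (t'₀ := -1/4) (U₀ := 8) (r := 1/20) (cU := 0)
    (by norm_num) (by norm_num) (by norm_num) (by norm_num) (by norm_num) hP
    (fun s hs V hV => faceCap_excess_upperHalf h445 h257lo h257up hτ3 hs hV)
    (by rw [max_le_iff]; constructor <;> norm_num) (by rw [sub_self, max_self]; norm_num) (by norm_num) ht hUm hω hρ hmin

/-- **ORDER-PARAMETER CEILING ON THE LOWER-`U` HALF-FACE**: for every `(t', U) ∈ [−0.30, −0.20] × [7.5, 8]`, every translation-invariant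
density-7/8 GROUND STATE has **`Re ω(P₀^d) ≤ 1.0581856`** (slot `330683/312500`; downward in `U` pays the kinematic `(8 − U)·7/16 ≤ 7/32`,
excess `1.0872271385/20 + 1.6212/20 + 7/32 = 0.35417…`). Premises as above. Ceiling only; no phase sentence. -/
theorem pin2_A0menu_L2_g0_groundState_pairAmp_le_on_tPrimeUFace_lowerHalf {t' U : ℝ} (ht : t' ∈ Set.Icc (-3/10 : ℝ) (-1/5))
    (hUm : U ∈ Set.Icc (15/2 : ℝ) 8)
    {ω : InfVolFermionState 2} (hω : ω.IsTranslationInvariant) (hρ : ω.density = 7 / 8)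
    (hmin : ∀ ω' : InfVolFermionState 2, ω'.IsTranslationInvariant → ω'.density = 7 / 8 →
      ω.meanEnergy (hubbardTTPrimeSourcedInteraction 1 t' U 0 dWaveFormFactor 0) 1 ≤
        ω'.meanEnergy (hubbardTTPrimeSourcedInteraction 1 t' U 0 dWaveFormFactor 0) 1) :
    (ω.expect (pairRegion (insert 0 unitSteps) 0) (localPairAt (insert 0 unitSteps) dWaveFormFactor 0)).re ≤
      (((330683/312500 : ℚ)) : ℝ) := by
  refine pairAmp_le_slot_on_tPrimeUBox_of_pricedNode (t'₀ := -1/4) (U₀ := 8) (r := 1/20) (cU := 7/32)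
    (by norm_num) (by norm_num) (by norm_num) (by norm_num) (by norm_num) hP
    (fun s hs V hV => faceCap_excess_lowerHalf h445 h257lo h257up hτ3 hs hV)
    (by rw [max_le_iff]; constructor <;> norm_num) (by rw [max_eq_left (by norm_num : (0:ℝ) ≤ 8 - 15/2)]; norm_num) (by norm_num)
    ht hUm hω hρ hmin

/-- **ORDER-PARAMETER CEILING ON THE WHOLE `(t', U)` FACE OF THE CUPRATE BOX** `[−0.30, −0.20] × [7.5, 8.5]` at `n = 7/8`: every
translation-invariant density-7/8 GROUND STATE of the `t–t'` Hubbard model at any `(t', U)` of the face has **`Re ω(P₀^d) ≤ 1.0581856`**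
(the lower-half slot; `≤ 0.9137975` on the upper half, `≤ 0.8740155` on the `U = 8` segment, `0.7600015` at the anchor point). Premises BY
NAME: priced A0 L2 g=0 node (CANDIDATE), #445, #257 docc rows, `hτ3`. Ceiling only; never a floor; no phase sentence. -/
theorem pin2_A0menu_L2_g0_groundState_pairAmp_le_on_tPrimeUFace {t' U : ℝ} (ht : t' ∈ Set.Icc (-3/10 : ℝ) (-1/5))
    (hUm : U ∈ Set.Icc (15/2 : ℝ) (17/2))
    {ω : InfVolFermionState 2} (hω : ω.IsTranslationInvariant) (hρ : ω.density = 7 / 8)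
    (hmin : ∀ ω' : InfVolFermionState 2, ω'.IsTranslationInvariant → ω'.density = 7 / 8 →
      ω.meanEnergy (hubbardTTPrimeSourcedInteraction 1 t' U 0 dWaveFormFactor 0) 1 ≤
        ω'.meanEnergy (hubbardTTPrimeSourcedInteraction 1 t' U 0 dWaveFormFactor 0) 1) :
    (ω.expect (pairRegion (insert 0 unitSteps) 0) (localPairAt (insert 0 unitSteps) dWaveFormFactor 0)).re ≤
      (((330683/312500 : ℚ)) : ℝ) := by
  rcases le_total U 8 with hle | hge
  · exact pin2_A0menu_L2_g0_groundState_pairAmp_le_on_tPrimeUFace_lowerHalf hP h445 h257lo h257up hτ3 ht ⟨hUm.1, hle⟩ hω hρ hmin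
  · refine (pin2_A0menu_L2_g0_groundState_pairAmp_le_on_tPrimeUFace_upperHalf hP h445 h257lo h257up hτ3 ht ⟨hge, hUm.2⟩
      hω hρ hmin).trans ?_
    norm_num

end Face

/-! ### §3 The LOWER-`U` half-face with the ROW-FREE docc cap (`DWaveSourceCapClassTPrimeTransport` §10): `7/16 → (R + 1.6212·(1+|t'|))/U` -/

/-- **`(t', U)`-BOX CEILING BELOW THE ANCHOR'S `U` WITH THE ROW-FREE DOCC CAP** (ground-state class, `h = 0`): priced node at `(t'₀, U₀, 0)`,
uniform target caps `e(1,t',U;n) ≤ u₀ + c_R` on `[s₁,s₂] × [U₁,U₀]` (`U₁ > 0`), `|t'₀ − t'| ≤ r` and `|t'| ≤ τ` on `[s₁,s₂]`,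
`X := u₀ + c_R + 1.6212(1 + τ) ≥ 0`, and the slot inequality `M̃ + κ·(c_R + 1.6212 r + (U₀ − U₁)·X/U₁) ≤ M·1.41421356` give `Re ω(P₀^d) ≤ M`
for every translation-invariant density-`n` ground state at every `(t', U)` of the box (`groundStateMinimiser_le_priced_of_capClass_tPrime_U_doccKinematic`:
the target state's double occupancy is `≤ (R + (16/π²)(1 + |t'|))/U`, no docc row). Ceiling only. -/
theorem pairAmp_le_slot_on_tPrimeUBox_below_of_pricedNode_doccKinematic {t'₀ U₀ n u₀ Mt κ M cR r τ s₁ s₂ U₁ : ℝ}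
    (hU₁ : 0 < U₁) (hn0 : 0 ≤ n) (hn2 : n < 2) (hκ : 0 ≤ κ) (hM : 0 ≤ M)
    (hP : ∀ σ : InfVolFermionState 2, σ.IsTranslationInvariant → σ.density = n →
      Real.sqrt 2 * (σ.expect (pairRegion (insert 0 unitSteps) 0) (localPairAt (insert 0 unitSteps) dWaveFormFactor 0)).re ≤
        Mt + κ * (σ.meanEnergy (hubbardTTPrimeSourcedInteraction 1 t'₀ U₀ 0 dWaveFormFactor 0) 1 - u₀))
    (hR : ∀ t' ∈ Set.Icc s₁ s₂, ∀ U ∈ Set.Icc U₁ U₀, energyDensityTT' 1 t' U n ≤ u₀ + cR)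
    (hr : max (t'₀ - s₁) (s₂ - t'₀) ≤ r) (hτ : max (-s₁) s₂ ≤ τ) (hpos : 0 ≤ u₀ + cR + 1.6212 * (1 + τ))
    (hslot : Mt + κ * (cR + 1.6212 * r + (U₀ - U₁) * ((u₀ + cR + 1.6212 * (1 + τ)) / U₁)) ≤ M * (141421356 / 100000000 : ℝ))
    {t' U : ℝ} (ht : t' ∈ Set.Icc s₁ s₂) (hUm : U ∈ Set.Icc U₁ U₀)
    {ω : InfVolFermionState 2} (hω : ω.IsTranslationInvariant) (hρ : ω.density = n)
    (hmin : ∀ ω' : InfVolFermionState 2, ω'.IsTranslationInvariant → ω'.density = n →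
      ω.meanEnergy (hubbardTTPrimeSourcedInteraction 1 t' U 0 dWaveFormFactor 0) 1 ≤
        ω'.meanEnergy (hubbardTTPrimeSourcedInteraction 1 t' U 0 dWaveFormFactor 0) 1) :
    (ω.expect (pairRegion (insert 0 unitSteps) 0) (localPairAt (insert 0 unitSteps) dWaveFormFactor 0)).re ≤ M := by
  have hU : 0 < U := lt_of_lt_of_le hU₁ hUm.1
  have key := groundStateMinimiser_le_priced_of_capClass_tPrime_U_doccKinematic
    (f := fun σ => Real.sqrt 2 * (σ.expect (pairRegion (insert 0 unitSteps) 0)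
      (localPairAt (insert 0 unitSteps) dWaveFormFactor 0)).re) hU hUm.2 hn0 hn2 hκ hP (hR t' ht U hUm) hω hρ hmin
  have hpi := sixteen_div_pi_sq_lt_decimal
  have hpi0 : (0 : ℝ) ≤ 16 / Real.pi ^ 2 := by positivity
  -- |t'₀ − t'| ≤ r and |t'| ≤ τ
  have habs : |t'₀ - t'| ≤ r := by
    refine le_trans ?_ hr
    rw [abs_le]; constructor
    · have := le_max_right (t'₀ - s₁) (s₂ - t'₀); linarith [ht.2]
    · have := le_max_left (t'₀ - s₁) (s₂ - t'₀); linarith [ht.1]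
  have habt : |t'| ≤ τ := by
    refine le_trans ?_ hτ
    rw [abs_le]; constructor
    · have := le_max_left (-s₁) s₂; linarith [ht.1]
    · have := le_max_right (-s₁) s₂; linarith [ht.2]
  -- the numerator X(t') ≤ Xmax
  have hX : u₀ + cR + 16 / Real.pi ^ 2 * (1 + |t'|) ≤ u₀ + cR + 1.6212 * (1 + τ) := by
    have h1 : 0 ≤ 1 + |t'| := by positivity
    nlinarith [mul_le_mul_of_nonneg_right hpi.le h1, abs_nonneg t']
  have hX1 : (u₀ + cR + 16 / Real.pi ^ 2 * (1 + |t'|)) / U ≤ (u₀ + cR + 1.6212 * (1 + τ)) / U :=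
    div_le_div_of_nonneg_right hX hU.le
  have hX2 : (u₀ + cR + 1.6212 * (1 + τ)) / U ≤ (u₀ + cR + 1.6212 * (1 + τ)) / U₁ :=
    div_le_div_of_nonneg_left hpos hU₁ hUm.1
  have hq0 : 0 ≤ (u₀ + cR + 1.6212 * (1 + τ)) / U₁ := div_nonneg hpos hU₁.le
  have hD : (U₀ - U) * ((u₀ + cR + 16 / Real.pi ^ 2 * (1 + |t'|)) / U) ≤
      (U₀ - U₁) * ((u₀ + cR + 1.6212 * (1 + τ)) / U₁) := by
    have h3 : (U₀ - U) * ((u₀ + cR + 16 / Real.pi ^ 2 * (1 + |t'|)) / U) ≤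
        (U₀ - U) * ((u₀ + cR + 1.6212 * (1 + τ)) / U₁) :=
      mul_le_mul_of_nonneg_left (hX1.trans hX2) (sub_nonneg.2 hUm.2)
    have h4 : (U₀ - U) * ((u₀ + cR + 1.6212 * (1 + τ)) / U₁) ≤ (U₀ - U₁) * ((u₀ + cR + 1.6212 * (1 + τ)) / U₁) :=
      mul_le_mul_of_nonneg_right (by linarith [hUm.1]) hq0
    exact h3.trans h4
  have h0 : 0 ≤ |t'₀ - t'| := abs_nonneg _
  have hκ2 : κ * (u₀ + cR + 16 / Real.pi ^ 2 * |t'₀ - t'| +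
      (U₀ - U) * ((u₀ + cR + 16 / Real.pi ^ 2 * (1 + |t'|)) / U) - u₀) ≤
      κ * (cR + 1.6212 * r + (U₀ - U₁) * ((u₀ + cR + 1.6212 * (1 + τ)) / U₁)) := by
    apply mul_le_mul_of_nonneg_left _ hκ
    nlinarith [mul_le_mul_of_nonneg_left habs (show (0:ℝ) ≤ 1.6212 by norm_num), mul_le_mul_of_nonneg_right hpi.le h0]
  exact le_slot_of_sqrt_two_mul_le (by simpa using key.trans (by linarith)) hM hslot

section FaceBelow

variable (hP : cert_pin2_A0menu_L2_U8_n7o8_tpm1o4_g0_pairAmpMax_priced_j256528) (h445 : cert_dbt329pair_allk)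
  (h257lo : cert_r257_lro_M3U8tpm1o4_w2_b4_kry1_kry2c3_hop2_Dlo)
  (h257up : cert_r257_lro_M3U8tpm1o4_w2_b4_kry1_kry2c3_hop2_Dup)
  (hτ3 : ∀ (ω : InfVolFermionState 2) (Ls : ℕ → ℕ) (ψ : ∀ L, Fock (Orb (FermionTorus 2 L))),
    Filter.Tendsto Ls Filter.atTop Filter.atTop →
    (∀ j, IsGroundStateInSector (hubbardTorusTT' (Ls j) 1 (-1/4) 8) (rectN (7/8) (Ls j)) 0 (ψ (Ls j))) →
    (∀ j, star (ψ (Ls j)) ⬝ᵥ ψ (Ls j) = 1) → ω.IsTorusLimitOf ψ Ls →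
    ((-6023622597/10000000000 : ℚ) : ℝ) ≤ ω.meanEnergy (hubbardTTPrimeFermionInteraction 0 1 0) 1 ∧
      ω.meanEnergy (hubbardTTPrimeFermionInteraction 0 1 0) 1 ≤ ((2174454277/2000000000 : ℚ) : ℝ))

include hP h445 h257lo h257up hτ3

/-- **ORDER-PARAMETER CEILING ON THE LOWER-`U` HALF-FACE, row-free docc edition**: for every `(t', U) ∈ [−0.30, −0.20] × [7.5, 8]`, every
translation-invariant density-7/8 GROUND STATE of the `t–t'` Hubbard model has **`Re ω(P₀^d) ≤ 0.9568201`** (slot `9568201/10000000`; the kinematic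
`(8 − U)·7/16` of `…_lowerHalf` (slot 1.0581856) replaced by `(8 − U)·(hi₄₄₅ + 1.0872271385/20 + 1.6212·13/10)/(15/2)`, i.e. excess
`0.0544 + 0.0811 + 0.0984 = 0.2338`). Premises BY NAME: priced A0 L2 g=0 node (CANDIDATE), #445, #257 docc rows, `hτ3`. Ceiling only; no phase sentence. -/
theorem pin2_A0menu_L2_g0_groundState_pairAmp_le_on_tPrimeUFace_lowerHalf_doccKinematic {t' U : ℝ}
    (ht : t' ∈ Set.Icc (-3/10 : ℝ) (-1/5)) (hUm : U ∈ Set.Icc (15/2 : ℝ) 8)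
    {ω : InfVolFermionState 2} (hω : ω.IsTranslationInvariant) (hρ : ω.density = 7 / 8)
    (hmin : ∀ ω' : InfVolFermionState 2, ω'.IsTranslationInvariant → ω'.density = 7 / 8 →
      ω.meanEnergy (hubbardTTPrimeSourcedInteraction 1 t' U 0 dWaveFormFactor 0) 1 ≤
        ω'.meanEnergy (hubbardTTPrimeSourcedInteraction 1 t' U 0 dWaveFormFactor 0) 1) :
    (ω.expect (pairRegion (insert 0 unitSteps) 0) (localPairAt (insert 0 unitSteps) dWaveFormFactor 0)).re ≤
      (((9568201/10000000 : ℚ)) : ℝ) := by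
  refine pairAmp_le_slot_on_tPrimeUBox_below_of_pricedNode_doccKinematic (t'₀ := -1/4) (U₀ := 8) (r := 1/20) (τ := 3/10)
    (cR := (2174454277/2000000000 : ℝ) / 20)
    (by norm_num) (by norm_num) (by norm_num) (by norm_num) (by norm_num) hP
    (fun s hs V hV => faceCap_excess_lowerHalf h445 h257lo h257up hτ3 hs hV)
    (by rw [max_le_iff]; constructor <;> norm_num) (by rw [max_le_iff]; constructor <;> norm_num) (by norm_num) (by norm_num)
    ht hUm hω hρ hmin

/-- **ORDER-PARAMETER CEILING ON THE WHOLE `(t', U)` FACE, row-free docc edition** `[−0.30, −0.20] × [7.5, 8.5]` at `n = 7/8`: every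
translation-invariant density-7/8 GROUND STATE at any `(t', U)` of the face has **`Re ω(P₀^d) ≤ 0.9568201`** (lower half by the row-free
docc cap, upper half `0.9137975`). Premises BY NAME: priced A0 L2 g=0 node (CANDIDATE), #445, #257 docc rows, `hτ3`. Ceiling only; never a floor;
no phase sentence. -/
theorem pin2_A0menu_L2_g0_groundState_pairAmp_le_on_tPrimeUFace_v2 {t' U : ℝ} (ht : t' ∈ Set.Icc (-3/10 : ℝ) (-1/5))
    (hUm : U ∈ Set.Icc (15/2 : ℝ) (17/2))
    {ω : InfVolFermionState 2} (hω : ω.IsTranslationInvariant) (hρ : ω.density = 7 / 8)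
    (hmin : ∀ ω' : InfVolFermionState 2, ω'.IsTranslationInvariant → ω'.density = 7 / 8 →
      ω.meanEnergy (hubbardTTPrimeSourcedInteraction 1 t' U 0 dWaveFormFactor 0) 1 ≤
        ω'.meanEnergy (hubbardTTPrimeSourcedInteraction 1 t' U 0 dWaveFormFactor 0) 1) :
    (ω.expect (pairRegion (insert 0 unitSteps) 0) (localPairAt (insert 0 unitSteps) dWaveFormFactor 0)).re ≤
      (((9568201/10000000 : ℚ)) : ℝ) := by
  rcases le_total U 8 with hle | hge
  · exact pin2_A0menu_L2_g0_groundState_pairAmp_le_on_tPrimeUFace_lowerHalf_doccKinematic hP h445 h257lo h257up hτ3 ht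
      ⟨hUm.1, hle⟩ hω hρ hmin
  · refine (pin2_A0menu_L2_g0_groundState_pairAmp_le_on_tPrimeUFace_upperHalf hP h445 h257lo h257up hτ3 ht ⟨hge, hUm.2⟩
      hω hρ hmin).trans ?_
    norm_num

end FaceBelow

end Summit.Ventures.CertifiedManyBodySolver.Certificates

end
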